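import Literature.Probability.LatticeModels.GibbsTailTriviality
import Literature.Probability.LatticeModels.GibbsStates
import Literature.Probability.LatticeModels.GibbsSpecificationProofs
import Literature.Probability.LatticeModels.PlusMinusStateGibbs
import HarnessLib

/-!
# Aizenman–Higuchi: reduction of the mixture statement to the two-phase dichotomy for
# tail-trivial Gibbs measures

Topic `Probability/LatticeModels`; theorems only. The Aizenman–Higuchi theorem is stated in
`GibbsStates.lean` (`aizenman_higuchi`, crit-ising.S25) in *mixture form*: for `β > β_c(2)` every
`μ ∈ 𝒢(β, 0)` on `ℤ²` is `t μ⁺ + (1 - t) μ⁻`. Georgii–Higuchi (J. Math. Phys. 41 (2000), §1,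
Theorem, p. 1) prove it in *extremal form* — "there exist only two distinct extremal Gibbs
measures `μ⁺` and `μ⁻`" — and pass to the mixture form by the extremal decomposition (§2, p. 3;
§5: "Together with Corollary 3.2 this will immediately imply the main theorem that each Gibbs
measure is a mixture of the two phases"). This file formalises that passage using the tail
disintegration `μ = ∫ π^ω μ(dω)` of `GibbsTailDisintegration` / `GibbsTailTriviality`
(a.e. `π^ω` is a tail-trivial Gibbs measure):

* `exists_eq_smul_add_smul_of_ae_condExpKernel_tail` — if a.e. conditional measure `π^ω` is one
  of two probability measures `ν₁, ν₂`, then `μ = t ν₁ + (1 - t) ν₂` with `t ≤ 1`;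
* **`aizenman_higuchi_of_tailTrivial_dichotomy`** — if every *tail-trivial* `μ ∈ 𝒢(β, 0)` on
  `ℤ²` has the correlations of `⟨·⟩⁺_β` or of `⟨·⟩⁻_β` (the Georgii–Higuchi theorem for
  `ex 𝒢 = ` tail-trivial Gibbs measures, Georgii 2011 Thm. 7.7), then `aizenman_higuchi` holds at
  `β`.

The remaining input, the two-phase dichotomy itself (Georgii–Higuchi 2000, §§3–5), is not in
this file.

## References

* H.-O. Georgii, Y. Higuchi, J. Math. Phys. 41 (2000) 1153–1169, §1 Theorem, §2 p. 3, §5 p. 12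
  [GeorgiiHiguchi2000].
* H.-O. Georgii, *Gibbs Measures and Phase Transitions*, 2nd ed. 2011, Thm. 7.26 [Georgii2011].
-/

noncomputable section

open MeasureTheory ProbabilityTheory Filter
open scoped ENNReal ProbabilityTheory

namespace Literature.Probability.LatticeModels

/-! ### Two-valued tail kernels give two-component mixtures -/

section Mixture

variable {V S : Type*} [MeasurableSpace S] [Countable V] [StandardBorelSpace S]

/-- If the conditional measures `π^ω = condExpKernel μ 𝒯 ω` of a probability measure `μ` are
a.e. equal to `ν₁` or to `ν₂` (two probability measures), then `μ` is the mixture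
`μ(π = ν₁) ν₁ + (1 - μ(π = ν₁)) ν₂` (barycentre formula `μ = ∫ π^ω μ(dω)`, Georgii 2011,
Thm. 7.26; the step "each Gibbs measure is a mixture of the two phases" of Georgii–Higuchi 2000,
§5, p. 12). [cite: Georgii2011, Thm. 7.26] -/
theorem exists_eq_smul_add_smul_of_ae_condExpKernel_tail (μ ν₁ ν₂ : Measure (V → S))
    [IsProbabilityMeasure μ] [IsProbabilityMeasure ν₁] [IsProbabilityMeasure ν₂]
    (h : ∀ᵐ ω ∂μ, condExpKernel μ (tailEvents V S) ω = ν₁ ∨ condExpKernel μ (tailEvents V S) ω = ν₂) :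
    ∃ t : ℝ≥0∞, t ≤ 1 ∧ μ = t • ν₁ + (1 - t) • ν₂ := by
  set π := condExpKernel μ (tailEvents V S) with hπ
  have hm : tailEvents V S ≤ (MeasurableSpace.pi : MeasurableSpace (V → S)) := tailEvents_le_pi
  have hmeas : Measurable (π : (V → S) → Measure (V → S)) := π.measurable.mono hm le_rfl
  have hbind : μ.bind π = μ := bind_condExpKernel_tail μ
  have hμA : ∀ A, MeasurableSet A → μ A = ∫⁻ ω, π ω A ∂μ := fun A hA => by
    conv_lhs => rw [← hbind]
    exact Measure.bind_apply hA hmeas.aemeasurable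
  by_cases heq : ν₁ = ν₂
  · -- degenerate case: `μ = ν₁`
    refine ⟨1, le_rfl, ?_⟩
    rw [tsub_self, zero_smul, add_zero, one_smul]
    ext A hA
    rw [hμA A hA]
    have hae : ∀ᵐ ω ∂μ, π ω A = ν₁ A := by
      filter_upwards [h] with ω hω
      rcases hω with h1 | h2
      · rw [h1]
      · rw [h2, heq]
    rw [lintegral_congr_ae hae, lintegral_const, measure_univ, mul_one]
  · -- a separating event `A₀` and the tail-measurable set `E = {π(A₀) = ν₁(A₀)}`
    have hsep : ∃ A₀, MeasurableSet A₀ ∧ ν₁ A₀ ≠ ν₂ A₀ := by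
      by_contra hall
      refine heq (Measure.ext fun A hA => ?_)
      by_contra hne
      exact hall ⟨A, hA, hne⟩
    obtain ⟨A₀, hA₀, hne⟩ := hsep
    set E : Set (V → S) := {ω | π ω A₀ = ν₁ A₀} with hE
    have hEm : MeasurableSet E :=
      ((measurable_condExpKernel hA₀).mono hm le_rfl) (measurableSet_singleton (ν₁ A₀))
    have hiff : ∀ᵐ ω ∂μ, ∀ A, π ω A = E.indicator (fun _ => ν₁ A) ω + Eᶜ.indicator (fun _ => ν₂ A) ω := by
      filter_upwards [h] with ω hω A
      rcases hω with h1 | h2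
      · have hωE : ω ∈ E := by simp [hE, h1]
        rw [Set.indicator_of_mem hωE, Set.indicator_of_notMem (Set.notMem_compl_iff.2 hωE), add_zero,
          h1]
      · have hωE : ω ∉ E := by
          simp only [hE, Set.mem_setOf_eq, h2]
          exact hne.symm
        rw [Set.indicator_of_notMem hωE, Set.indicator_of_mem (show ω ∈ Eᶜ from hωE), zero_add,
          h2]
    refine ⟨μ E, prob_le_one, ?_⟩
    ext A hA
    rw [hμA A hA, Measure.add_apply, Measure.smul_apply, Measure.smul_apply, smul_eq_mul,
      smul_eq_mul, ← prob_compl_eq_one_sub hEm]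
    have hae : (fun ω => π ω A) =ᵐ[μ]
        fun ω => E.indicator (fun _ => ν₁ A) ω + Eᶜ.indicator (fun _ => ν₂ A) ω :=
      hiff.mono fun ω hω => hω A
    rw [lintegral_congr_ae hae, lintegral_add_left (measurable_const.indicator hEm),
      lintegral_indicator_const hEm, lintegral_indicator_const hEm.compl, mul_comm (ν₁ A),
      mul_comm (ν₂ A)]

end Mixture

/-! ### The reduction for the Ising model on `ℤ²` -/

variable {β : ℝ}

/-- **Aizenman–Higuchi from the two-phase dichotomy for tail-trivial Gibbs measures.**
Suppose that at an inverse temperature `β > β_c(2)` every tail-trivial infinite-volume Ising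
Gibbs measure on `ℤ²` at zero field has either the correlations `⟨σ_A⟩⁺_β` of the plus state or the
correlations `⟨σ_A⟩⁻_β` of the minus state (the theorem of Aizenman and Higuchi in the form
proved by Georgii–Higuchi 2000, §1 Theorem / §5: `ex 𝒢 = {μ⁺, μ⁻}`, extremal = tail trivial by
Georgii 2011 Thm. 7.7). Then every `μ ∈ 𝒢(β, 0)` is a mixture `t μ⁺ + (1 - t) μ⁻`, i.e.
`aizenman_higuchi` holds at `β`: the conditional measures `π^ω` of `μ` given the tail σ-algebra
are a.s. tail-trivial Gibbs measures (`GibbsTailTriviality`), hence a.s. equal to `μ⁺` or `μ⁻`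
(a probability measure on `{±1}^{ℤ²}` is determined by its correlations), and
`μ = ∫ π^ω μ(dω) = μ(π = μ⁺) μ⁺ + μ(π = μ⁻) μ⁻` (Georgii–Higuchi 2000, §5, p. 12: "Together with
Corollary 3.2 this will immediately imply the main theorem that each Gibbs measure is a mixture of
the two phases"). [cite: GeorgiiHiguchi2000, §5 p. 12] -/
theorem aizenman_higuchi_of_tailTrivial_dichotomy
    (hcore : criticalBeta 2 < β → ∀ μ ∈ isingGibbsMeasures 2 β 0, IsTailTrivial μ →
      (∀ A, spinCorr μ A = plusCorr 2 β 0 A) ∨ (∀ A, spinCorr μ A = minusCorr 2 β 0 A)) :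
    aizenman_higuchi (β := β) := by
  intro hβ μ hμ
  replace hcore := hcore hβ
  have hβ0 : 0 ≤ β := (criticalBeta_nonneg 2).trans hβ.le
  obtain ⟨μp, hμpG, -, hμp⟩ := exists_plusMeasure_holds (d := 2) (β := β) (h := 0) hβ0
  obtain ⟨μm, hμmG, -, hμm⟩ := exists_minusMeasure_holds (d := 2) (β := β) (h := 0) hβ0
  refine ⟨μp, μm, hμpG, hμmG, hμp, hμm, ?_⟩
  have hγ : IsSpecification (isingSpecification (zdGraph 2) β 0) :=
    isSpecification_isingSpecification_zd_holds 2 β 0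
  have hμG : IsGibbsMeasure (isingSpecification (zdGraph 2) β 0) μ := hμ
  have hμpG' : IsGibbsMeasure (isingSpecification (zdGraph 2) β 0) μp := hμpG
  have hμmG' : IsGibbsMeasure (isingSpecification (zdGraph 2) β 0) μm := hμmG
  haveI := hμG.isProbabilityMeasure
  haveI := hμpG'.isProbabilityMeasure
  haveI := hμmG'.isProbabilityMeasure
  refine exists_eq_smul_add_smul_of_ae_condExpKernel_tail μ μp μm ?_
  filter_upwards [hμG.ae_isGibbsMeasure_condExpKernel_tail hγ,
    hμG.ae_isTailTrivial_condExpKernel_tail hγ] with ω h1 h2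
  haveI := h1.isProbabilityMeasure
  rcases hcore _ h1 h2 with h | h
  · exact Or.inl (measure_eq_of_forall_spinCorr_eq _ _ fun B => by rw [h B, hμp B])
  · exact Or.inr (measure_eq_of_forall_spinCorr_eq _ _ fun B => by rw [h B, hμm B])

end Literature.Probability.LatticeModels
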